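import Mathlib
import Literature.Analysis.Matrix.BandMatrix

/-!
# HHT effective matrix: band structure, conditioning under the mass shift, solve counts

DEQ-A164 staging file (pub-qadeq / deq-1). Honest framing: instance-level adjudication of specific
advantage claims; no claim about BQP vs BPP or the summit.

The hybrid `HHL-embedded Newton–Raphson' scheme of Research Square rs-10155554/v1 solves, at
every Newton iteration, `K_T Δu = R` with `K_T = c₀ M + c₁ C + d K_tan`, `C = a M + b K₀`
(Rayleigh).  For a shear building `M` is diagonal and `K₀`, `K_tan` are tridiagonal, so `K_T` is
tridiagonal (`hht_matrix_banded`, and `hht_hasLowerBandwidth` / `hht_cholesky_banded` over the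
tree's `Literature.Analysis.Matrix.Band` predicates, with `p = 1`) and the classical solve costs
`8N - 7` flops (`thomasFlops`, Golub–Van Loan Alg. 4.3.6), not `O(N³)`.  The mass shift
`c = m/(β Δt²) > 0` can only improve conditioning (`kappa_shift_le`) and makes
`κ(K_T) ≤ 1 + λ_max/c` (`kappa_shift_le_one_add`).  `toffoli_vs_thomas`: with the paper's own
hardware reference (one logical Toffoli ≈ 170 μs) a single Toffoli exceeds 330 whole tridiagonal
solves at `N = 64` on a 10⁹ flop/s classical machine.
-/

namespace Summit.QuantumAdvantage.Dequantization.HHTShift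

open Matrix

section band

variable {N : ℕ} {R : Type*} [CommRing R]

/-- `Nat.dist i i = 0`, so a strict band condition forces `i ≠ j`. -/
theorem ne_of_lt_dist (p : ℕ) (i j : Fin N) (h : p < Nat.dist (i : ℕ) j) : i ≠ j := by
  rintro rfl
  simp [Nat.dist_self] at h

/-- Band width `p` is preserved by the HHT combination `c₀ M + c₁ (a M + b K₀) + d K_tan` when
`M` is diagonal and `K₀`, `K_tan` have band width `p` (shear building: `p = 1`, tridiagonal). -/
theorem hht_matrix_banded (p : ℕ) (M K₀ Kt : Matrix (Fin N) (Fin N) R) (c₀ c₁ a b d : R)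
    (hM : ∀ i j : Fin N, i ≠ j → M i j = 0)
    (hK₀ : ∀ i j : Fin N, p < Nat.dist (i : ℕ) j → K₀ i j = 0)
    (hKt : ∀ i j : Fin N, p < Nat.dist (i : ℕ) j → Kt i j = 0) :
    ∀ i j : Fin N, p < Nat.dist (i : ℕ) j →
      (c₀ • M + c₁ • (a • M + b • K₀) + d • Kt) i j = 0 := by
  intro i j h
  have hij : i ≠ j := ne_of_lt_dist p i j h
  simp [Matrix.add_apply, Matrix.smul_apply, hM i j hij, hK₀ i j h, hKt i j h]

/-- A matrix of band width `p` applied to a vector: entry `i` only reads the `x j` with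
`Nat.dist i j ≤ p` (a matrix–vector product costs `O(p N)`; for `p = 1` each row has at most
three non-zero entries: the sparsity `s = 3` in the paper's `O(s² κ² log N)`). -/
theorem banded_mulVec_eq (p : ℕ) (A : Matrix (Fin N) (Fin N) R) (x : Fin N → R)
    (hA : ∀ i j : Fin N, p < Nat.dist (i : ℕ) j → A i j = 0) (i : Fin N) :
    (A *ᵥ x) i =
      ∑ j ∈ Finset.univ.filter (fun j : Fin N => Nat.dist (i : ℕ) j ≤ p), A i j * x j := by
  rw [Matrix.mulVec, dotProduct, ← Finset.sum_filter_add_sum_filter_not Finset.univ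
    (fun j : Fin N => Nat.dist (i : ℕ) j ≤ p)]
  have h0 : ∑ j ∈ Finset.univ.filter (fun j : Fin N => ¬ Nat.dist (i : ℕ) j ≤ p),
      A i j * x j = 0 := by
    apply Finset.sum_eq_zero
    intro j hj
    rw [Finset.mem_filter] at hj
    rw [hA i j (by omega), zero_mul]
  rw [h0, add_zero]

end band

section treeBand

/-! ### The same statement over the tree's band predicates (GVL §1.2.1, `BandMatrix.lean`) -/

open Literature.Analysis.Matrix.Band

variable {N : ℕ} {R : Type*} [CommRing R]

/-- Lower bandwidth `p` of the HHT combination from diagonal `M` (lumped mass) and band-`p`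
stiffness matrices `K₀`, `K_tan`. -/
theorem hht_hasLowerBandwidth (p : ℕ) {M K₀ Kt : Matrix (Fin N) (Fin N) R} (c₀ c₁ a b d : R)
    (hM : HasLowerBandwidth M 0) (hK₀ : HasLowerBandwidth K₀ p)
    (hKt : HasLowerBandwidth Kt p) :
    HasLowerBandwidth (c₀ • M + c₁ • (a • M + b • K₀) + d • Kt) p :=
  (((hM.mono (Nat.zero_le p)).smul c₀).add
    ((((hM.mono (Nat.zero_le p)).smul a).add (hK₀.smul b)).smul c₁)).add (hKt.smul d)

/-- Upper bandwidth `q` of the HHT combination (symmetric data: `q = p`). -/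
theorem hht_hasUpperBandwidth (q : ℕ) {M K₀ Kt : Matrix (Fin N) (Fin N) R} (c₀ c₁ a b d : R)
    (hM : HasUpperBandwidth M 0) (hK₀ : HasUpperBandwidth K₀ q)
    (hKt : HasUpperBandwidth Kt q) :
    HasUpperBandwidth (c₀ • M + c₁ • (a • M + b • K₀) + d • Kt) q :=
  (((hM.mono (Nat.zero_le q)).smul c₀).add
    ((((hM.mono (Nat.zero_le q)).smul a).add (hK₀.smul b)).smul c₁)).add (hKt.smul d)

/-- **Banded `K_T` ⇒ banded Cholesky factor** (GVL Thm 4.3.1 / §4.3.5 via the tree lemma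
`HasLowerBandwidth.of_mul_transpose_self`): the classical direct solve of the HHT system needs
only the `p` sub-diagonals — `O(N p²)` work, `8N - 7` flops for the tridiagonal case `p = 1`. -/
theorem hht_cholesky_banded [NoZeroDivisors R] (p : ℕ) {M K₀ Kt G : Matrix (Fin N) (Fin N) R}
    (c₀ c₁ a b d : R) (hM : HasLowerBandwidth M 0) (hK₀ : HasLowerBandwidth K₀ p)
    (hKt : HasLowerBandwidth Kt p)
    (hGG : G * Gᵀ = c₀ • M + c₁ • (a • M + b • K₀) + d • Kt)
    (hG : HasUpperBandwidth G 0) (hdiag : ∀ j : Fin N, G j j ≠ 0) : HasLowerBandwidth G p :=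
  (hht_hasLowerBandwidth p c₀ c₁ a b d hM hK₀ hKt).of_mul_transpose_self hGG hG hdiag

/-- Lumped (diagonal) mass matrices have bandwidth `0`. -/
theorem lumpedMass_hasLowerBandwidth (m : Fin N → R) :
    HasLowerBandwidth (Matrix.diagonal m) 0 :=
  hasLowerBandwidth_diagonal m 0

end treeBand

section conditioning

/-- Shifting a positive spectrum `[lo, hi]` by `c ≥ 0` can only decrease the condition number. -/
theorem kappa_shift_le {lo hi c : ℝ} (hlo : 0 < lo) (hle : lo ≤ hi) (hc : 0 ≤ c) :
    (hi + c) / (lo + c) ≤ hi / lo := by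
  rw [div_le_div_iff₀ (by linarith) hlo]
  nlinarith

/-- With a shift `c > 0` the condition number is at most `1 + hi / c`, whatever `lo ≥ 0` is: the
HHT matrix `M/(β Δt²) + …` is well conditioned as soon as the mass term dominates. -/
theorem kappa_shift_le_one_add {lo hi c : ℝ} (hlo : 0 ≤ lo) (hle : lo ≤ hi) (hc : 0 < c) :
    (hi + c) / (lo + c) ≤ 1 + hi / c := by
  have h1 : (hi + c) / (lo + c) ≤ (hi + c) / c := by
    rw [div_le_div_iff₀ (by linarith) hc]
    nlinarith
  have h2 : (hi + c) / c = 1 + hi / c := by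
    rw [add_div, div_self hc.ne']
    ring
  linarith

/-- Conversely the shifted condition number is at least `1`. -/
theorem one_le_kappa_shift {lo hi c : ℝ} (hlo : 0 ≤ lo) (hle : lo ≤ hi) (hc : 0 < c) :
    1 ≤ (hi + c) / (lo + c) := by
  rw [le_div_iff₀ (by linarith)]
  linarith

end conditioning

section counts

/-- Flop count of the LDLᵀ tridiagonal solve (Golub–Van Loan, Matrix Computations, Alg. 4.3.6):
`3(N-1)` for the factorisation, `2(N-1)` forward, `1 + 3(N-1)` backward. -/
def thomasFlops (N : ℕ) : ℕ := 3 * (N - 1) + 2 * (N - 1) + (1 + 3 * (N - 1))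

/-- Closed form `8N − 7` of the tridiagonal solve's flop count for `N ≥ 1` (GVL4 Alg. 4.3.6, "8n flops"). -/
theorem thomasFlops_eq (N : ℕ) (hN : 1 ≤ N) : thomasFlops N = 8 * N - 7 := by
  unfold thomasFlops
  omega

/-- The tridiagonal solve costs at most `8N` flops. -/
theorem thomasFlops_le (N : ℕ) (hN : 1 ≤ N) : thomasFlops N ≤ 8 * N := by
  unfold thomasFlops
  omega

/-- At `N = 64` the tridiagonal solve is exactly `505` flops. -/
theorem thomasFlops_64 : thomasFlops 64 = 505 := by decide

/-- Dense LU (`2N³/3`, here cleared of the division) versus the tridiagonal solve: already at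
`N = 64` the ratio exceeds 300, and the gap grows like `N²`. -/
theorem dense_vs_thomas_64 : 300 * (3 * thomasFlops 64) < 2 * 64 ^ 3 := by decide

/-- For `N ≥ 12`, `N` tridiagonal solves (times three) still cost no more than ONE dense `2N³` count:
the dense-vs-banded gap grows like `N²`. -/
theorem thomas_quadratic_gap (N : ℕ) (hN : 12 ≤ N) :
    N * (3 * thomasFlops N) ≤ 2 * N ^ 3 := by
  have h := thomasFlops_le N (by omega)
  have h2 : 3 * thomasFlops N ≤ 24 * N := by omega
  calc N * (3 * thomasFlops N) ≤ N * (24 * N) := Nat.mul_le_mul_left N h2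
    _ = 24 * N ^ 2 := by ring
    _ ≤ 2 * N * N ^ 2 := by nlinarith
    _ = 2 * N ^ 3 := by ring

/-- The paper's own hardware reference (its ref. [13]): one logical Toffoli ≈ 170 μs.  At
`N = 64` a tridiagonal solve is 505 flops, i.e. `5.05e-7 s` at a deliberately slow `10⁹ flop/s`;
one Toffoli alone costs more than 330 such solves. -/
theorem toffoli_vs_thomas :
    (330 : ℝ) * ((thomasFlops 64 : ℕ) * (1 / 10 ^ 9)) < 170 / 10 ^ 6 := by
  rw [thomasFlops_64]
  norm_num

/-- Output size per Newton iteration: the hybrid loop hands the classical state determination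
a full increment `Δu ∈ ℝᴺ`; reading `N` real components off `n` qubits one shot at a time
needs at least `N / n` shots even at one component per measured qubit (cf. the tree lemma
`RiccatiSweep.packing` for the Holevo form). Only the trivial pigeonhole is recorded here. -/
theorem shots_lower_bound (N n shots : ℕ) (h : N ≤ shots * n) : N / n ≤ shots :=
  Nat.div_le_of_le_mul (by simpa [Nat.mul_comm] using h)

end counts

end Summit.QuantumAdvantage.Dequantization.HHTShift
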